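import Literature.Topology.FourManifolds.LefschetzHandlebody
import Literature.GroupTheory.CombinatorialGroupTheory.SignedHurwitzStabilisation
import HarnessLib

/-!
# Stub D-prim of line `folded-curve-branch-locus` reduced to one surface-topology fact
(crux `ConvexBisection.AcyclicBisectionRigidity`, item stmt-SmoothPoincare4-10507; lead a4, wave 2 audit)

The registered stub `stub_genusOnePrimitive` ("in a genus-`1` fibred Lefschetz model every letter with
non-zero shadow is a PRIMITIVE vector of `ℤ² = H₁(F_{1,1}; ℤ)`", needed because Matsumoto's normal form is
about transvections conjugate to `X^{±1}`) is the image, under the bookkeeping of `ModelsOnFibred`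
(`IsLefschetzLink.mem_page`, `IsLefschetzLink.shadow_eq`, `HandleAttachingMap.injective_attachingCircle`), of
ONE fact about the concrete genus-`1` page `page 1 c ⊂ ∂ Base 1` (on paper the open once-holed torus
`{‖x‖ < 2, y² = x³ + 1 + c/2}`): an injective continuous loop in it with non-zero homology shadow has
primitive shadow — Farb–Margalit, *A Primer on Mapping Class Groups* (2012), Prop. 1.5 with §1.2.2 (a simple
closed curve on the torus / once-holed torus is, up to sign, a primitive class or null-homologous).  That fact
is NOT in the tree (audit `stub_genusOnePrimitive_AUDIT.md` of the lead's folder); here it is an explicit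
HYPOTHESIS, written out, and the helper is pure logic.

## References
* B. Farb, D. Margalit, *A Primer on Mapping Class Groups*, PMS 49 (2012), Prop. 1.5, §1.2.2. [FarbMargalit2012]
-/

noncomputable section

open scoped Manifold ContDiff Topology
open Set Function
open Literature.Topology.FourManifolds Literature.Topology.FourManifolds.LefschetzBase
open Literature.GroupTheory.CombinatorialGroupTheory.SignedHurwitz

-- the prescribed namespace `Summit.<P>.<Sub>.…` duplicates `SmoothPoincare4` (P = Sub)
set_option linter.dupNamespace false

namespace Summit.SmoothPoincare4.SmoothPoincare4.Theorems.AcyclicBisectionRigidity.FoldedCurveBranchLocus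

/-- **Stub D-prim from the page-curve fact (pure logic).**  Hypothesis: every injective continuous loop in
a genus-`1` page `page 1 c` (`‖c‖ = 1`) of `∂ Base 1` with non-zero homology shadow has primitive shadow
(Farb–Margalit Prop. 1.5 read on the concrete page).  Conclusion: the registered signature of
`stub_genusOnePrimitive` verbatim — in a genus-`1` fibred model every letter with non-zero class is
primitive (the `i`-th class IS the shadow of the `i`-th attaching circle, an injective loop in the page of
direction `pageDir n i`). [cite: FarbMargalit2012, Prop. 1.5] -/
theorem helper_genusOnePrimitive_of :
    (∀ (c : ℂ), ‖c‖ = 1 →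
      ∀ (K : Metric.sphere (0 : EuclideanSpace ℝ (Fin 2)) 1 → Base 1) (hK : Continuous K),
        Function.Injective K → (∀ θ, K θ ∈ page 1 c) → shadow 1 K hK ≠ 0 →
          IsPrimitive (shadow 1 K hK)) →
    ∀ (M : Type) [TopologicalSpace M] [T2Space M] [SecondCountableTopology M]
      [ChartedSpace (EuclideanSpace ℝ (Fin 4)) M] [IsManifold (𝓡 4) ∞ M] (l : IntWord 1),
      ModelsOnFibred M 1 l → ∀ x ∈ l, x.1 ≠ 0 → IsPrimitive x.1 := by
  intro hfact M _ _ _ _ _ l hM x hx hx0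
  obtain ⟨X, _, _, _, _, _, _, h, D, bX, Ψ, hlink, -, -⟩ := hM
  obtain ⟨i, rfl⟩ := List.mem_iff_get.1 hx
  have hs := hlink.shadow_eq i
  rw [← hs] at hx0 ⊢
  exact hfact (pageDir l.length i) (norm_pageDir _ _) (h i).attachingCircle
    (h i).continuous_attachingCircle (h i).injective_attachingCircle (hlink.mem_page i) hx0

end Summit.SmoothPoincare4.SmoothPoincare4.Theorems.AcyclicBisectionRigidity.FoldedCurveBranchLocus

end
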